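import Summits.CriticalPhenomena.CardyFormulaZ2.Theorems.CardyComplexConeSLESixFamiliesGiveCardySmoothMarkFamiliesPart4
import Literature.Probability.RandomPlanarGeometry.HullComplement
import HarnessLib

/-!
# Smooth-mark discretisation families, part 5: the two arcs near a smooth mark are the two half-graphs

Helper file for stub `stub_smoothMarkFamilies` of line `collar-touch-sandwich` of crux
`SLESixFamiliesGiveCardy` (stmt-CriticalPhenomena-9654).  Let the Dobrushin domain `D` be, inside
`B(D.pt i, R)`, the strict epigraph of a monotone `1`-Lipschitz `G` in a frame `(U, V)`,
`D.pt i = α U + G α V`, with the other marked point outside this ball.  Then there is `σ : Fin 2`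
such that the graph points with parameter `> α` inside the ball lie on the arc `D.arc σ` and off the
other arc, and those with parameter `< α` lie on `D.arc (σ + 1)` and off `D.arc σ`
(`exists_side_arcs`; both marked points lie on both arcs, `DobrushinDomain.pt_mem_arc` of
`HullComplement.lean`).  Proof: each open half-graph inside the ball is connected and misses the two
marked points, so it lies inside one arc (the two arcs are closed, cover the frontier and meet only
at the marked points); both in the same arc would force the other arc, a connected set through
`D.pt i` containing the other marked point, to meet the ball only at `D.pt i`.
-/

noncomputable section

open Set Metric
open Literature.Probability Literature.Probability.RandomPlanarGeometry
  Literature.Probability.LatticeModels Literature.Probability.Percolation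

namespace Summit.CriticalPhenomena.CardyFormulaZ2.Cruxes.SLESixFamiliesGiveCardy.CollarTouchSandwich

namespace SmoothMark

/-! ### The two arcs of a Dobrushin domain -/

/-- The two marked points of a Dobrushin domain are `pt i` and `pt (i + 1)`, for either `i`.
[folklore] -/
theorem pt_zero_or_one_iff (D : DobrushinDomain) (i : Fin 2) (z : ℂ) :
    (z = D.pt 0 ∨ z = D.pt 1) ↔ (z = D.pt i ∨ z = D.pt (i + 1)) := by
  fin_cases i
  · simp
  · simp only [Fin.mk_one, Fin.isValue]
    rw [show (1 : Fin 2) + 1 = 0 from rfl, or_comm]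

/-- A common point of the two arcs of a Dobrushin domain is a marked point. [folklore] -/
theorem eq_pt_of_mem_arc_arc (D : DobrushinDomain) (i : Fin 2) {z : ℂ} (h0 : z ∈ D.arc 0)
    (h1 : z ∈ D.arc 1) : z = D.pt i ∨ z = D.pt (i + 1) :=
  (pt_zero_or_one_iff D i z).1 (D.mem_arc_inter_arc (i := 0) (k := 1) (by decide) h0 h1)

/-- A common point of `arc j` and `arc (j + 1)` is a marked point. [folklore] -/
theorem eq_pt_of_mem_arc_arc' (D : DobrushinDomain) (i j : Fin 2) {z : ℂ} (h0 : z ∈ D.arc j)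
    (h1 : z ∈ D.arc (j + 1)) : z = D.pt i ∨ z = D.pt (i + 1) := by
  fin_cases j
  · exact eq_pt_of_mem_arc_arc D i h0 h1
  · exact eq_pt_of_mem_arc_arc D i h1 h0

/-- The frontier of a Dobrushin domain is the union of its two arcs. [folklore] -/
theorem mem_frontier_iff_mem_arc (D : DobrushinDomain) (z : ℂ) :
    z ∈ frontier D.carrier ↔ z ∈ D.arc 0 ∨ z ∈ D.arc 1 := by
  rw [← D.iUnion_arc_holds, mem_iUnion, Fin.exists_fin_two]

/-! ### The half-graphs near a smooth mark lie on the two arcs -/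

section SideArcs

variable (D : DobrushinDomain) (i : Fin 2) {k : Fin 2} {s t : ℤ} {U V : ℂ} {G : ℝ → ℝ} {α R : ℝ}
  (hs : s = 1 ∨ s = -1) (ht : t = 1 ∨ t = -1)
  (hU : U = Site.toComplex (Pi.single k s)) (hV : V = Site.toComplex (Pi.single k.rev t))
  (hp : D.pt i = (α : ℂ) * U + ((G α : ℝ) : ℂ) * V) (hmono : Monotone G)
  (hlip : ∀ a b, |G a - G b| ≤ |a - b|)
  (hepi : ∀ a b : ℝ, dist ((a : ℂ) * U + (b : ℂ) * V) (D.pt i) < R →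
    ((a : ℂ) * U + (b : ℂ) * V ∈ D.carrier ↔ G a < b))
  (hfar : R ≤ dist (D.pt (i + 1)) (D.pt i))

include hs ht hU hV hp hmono in
/-- Along the half-graph `c ≥ α`, the distance to the mark is monotone in the parameter. [folklore] -/
theorem dist_graph_mono {c c' : ℝ} (hc : α ≤ c) (hcc' : c ≤ c') :
    dist ((c : ℂ) * U + ((G c : ℝ) : ℂ) * V) (D.pt i) ≤ dist ((c' : ℂ) * U + ((G c' : ℝ) : ℂ) * V) (D.pt i) := by
  rw [hp]
  refine le_of_sq_le_sq ?_ dist_nonneg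
  rw [dist_sq_frame hs ht hU hV, dist_sq_frame hs ht hU hV]
  have h1 := hmono hc
  have h2 := hmono hcc'
  nlinarith

include hs ht hU hV hp hmono in
/-- Along the half-graph `c ≤ α`, the distance to the mark is antitone in the parameter. [folklore] -/
theorem dist_graph_anti {c c' : ℝ} (hc : c ≤ α) (hcc' : c' ≤ c) :
    dist ((c : ℂ) * U + ((G c : ℝ) : ℂ) * V) (D.pt i) ≤ dist ((c' : ℂ) * U + ((G c' : ℝ) : ℂ) * V) (D.pt i) := by
  rw [hp]
  refine le_of_sq_le_sq ?_ dist_nonneg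
  rw [dist_sq_frame hs ht hU hV, dist_sq_frame hs ht hU hV]
  have h1 := hmono hc
  have h2 := hmono hcc'
  nlinarith

include hs ht hU hV hp in
/-- Graph points with parameter `≠ α` are not the mark. [folklore] -/
theorem graph_ne_pt {c : ℝ} (hc : c ≠ α) : (c : ℂ) * U + ((G c : ℝ) : ℂ) * V ≠ D.pt i := by
  intro h
  have h1 := (abs_sub_le_dist_frame hs ht hU hV c (G c) α (G α)).1
  rw [← hp, h, dist_self] at h1
  exact hc (by linarith [abs_nonneg (c - α), abs_le.1 h1])

include hlip in
/-- The graph map is continuous. [folklore] -/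
theorem continuous_graph : Continuous fun c : ℝ => (c : ℂ) * U + ((G c : ℝ) : ℂ) * V := by
  have hG : Continuous G := by
    refine continuous_iff_continuousAt.2 fun x => Metric.continuousAt_iff.2 fun ε hε => ⟨ε, hε, fun y hy => ?_⟩
    rw [Real.dist_eq] at hy ⊢
    exact (hlip y x).trans_lt hy
  fun_prop

include hs ht hU hV hp hmono hlip hepi hfar in
/-- **A half-graph inside the ball lies inside one arc.** The set of graph points with parameter
`> α` (resp. `< α`) within distance `R` of the mark is connected and avoids both marked points, so it
is contained in `D.arc 0` or in `D.arc 1`. [folklore] -/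
theorem halfGraph_subset_arc_or (hΩ : IsOpen D.carrier) (up : Bool) :
    (∀ c, (if up then α < c else c < α) → dist ((c : ℂ) * U + ((G c : ℝ) : ℂ) * V) (D.pt i) < R →
        (c : ℂ) * U + ((G c : ℝ) : ℂ) * V ∈ D.arc 0) ∨
      (∀ c, (if up then α < c else c < α) → dist ((c : ℂ) * U + ((G c : ℝ) : ℂ) * V) (D.pt i) < R →
        (c : ℂ) * U + ((G c : ℝ) : ℂ) * V ∈ D.arc 1) := by
  set γ : ℝ → ℂ := fun c => (c : ℂ) * U + ((G c : ℝ) : ℂ) * V with hγ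
  set T : Set ℝ := {c | (if up then α < c else c < α) ∧ dist (γ c) (D.pt i) < R} with hT
  -- `T` is order-connected, hence its image is preconnected
  have hTo : T.OrdConnected := by
    refine ⟨fun x hx y hy z hz => ⟨?_, ?_⟩⟩
    · cases up
      · have hy1 : y < α := hy.1
        exact hz.2.trans_lt hy1
      · have hx1 : α < x := hx.1
        exact hx1.trans_le hz.1
    · cases up
      · have hy1 : y < α := hy.1
        exact (dist_graph_anti D i hs ht hU hV hp hmono (hz.2.trans hy1.le) hz.1).trans_lt hx.2
      · have hx1 : α < x := hx.1
        exact (dist_graph_mono D i hs ht hU hV hp hmono (hx1.le.trans hz.1) hz.2).trans_lt hy.2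
  have hconn : IsPreconnected (γ '' T) :=
    hTo.isPreconnected.image γ (continuous_graph hlip).continuousOn
  -- the image lies in the union of the two (closed) arcs and misses their intersection
  have hsub : γ '' T ⊆ D.arc 0 ∪ D.arc 1 := by
    rintro _ ⟨c, hc, rfl⟩
    exact (mem_frontier_iff_mem_arc D _).1
      ((mem_frontier_iff_graph hs ht hU hV hΩ hlip hepi hc.2).2 ⟨c, rfl⟩)
  have hdisj : γ '' T ∩ (D.arc 0 ∩ D.arc 1) = ∅ := by
    ext z
    simp only [mem_inter_iff, mem_image, mem_empty_iff_false, iff_false, not_and, forall_exists_index,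
      and_imp]
    rintro c hc rfl h0 h1
    have hcα : c ≠ α := by
      have := hc.1; split_ifs at this <;> exact fun h => by simp [h] at this
    rcases eq_pt_of_mem_arc_arc D i h0 h1 with h | h
    · exact graph_ne_pt D i hs ht hU hV hp hcα h
    · have := hc.2; rw [h] at this; linarith
  rcases (isPreconnected_iff_subset_of_disjoint_closed.1 hconn) _ _ (D.isClosed_arc 0) (D.isClosed_arc 1)
    hsub hdisj with h | h
  · exact Or.inl fun c hc hd => h ⟨c, ⟨hc, hd⟩, rfl⟩
  · exact Or.inr fun c hc hd => h ⟨c, ⟨hc, hd⟩, rfl⟩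

include hs ht hU hV hp hlip hepi hfar in
/-- **Both half-graphs in the same arc is impossible.** Otherwise the other arc — connected,
through the mark, containing the other marked point outside the ball — would meet the ball only at
the mark. [folklore] -/
theorem not_both_halfGraphs_subset (hΩ : IsOpen D.carrier) (hR : 0 < R) (j : Fin 2)
    (hup : ∀ c, α < c → dist ((c : ℂ) * U + ((G c : ℝ) : ℂ) * V) (D.pt i) < R →
      (c : ℂ) * U + ((G c : ℝ) : ℂ) * V ∈ D.arc j)
    (hdn : ∀ c, c < α → dist ((c : ℂ) * U + ((G c : ℝ) : ℂ) * V) (D.pt i) < R →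
      (c : ℂ) * U + ((G c : ℝ) : ℂ) * V ∈ D.arc j) : False := by
  set A' : Set ℂ := D.arc (j + 1) with hA'
  have hconn : IsPreconnected A' := isPreconnected_Icc.image _ D.continuous_boundary.continuousOn
  have hpA : D.pt i ∈ A' := D.pt_mem_arc i (j + 1)
  have hqA : D.pt (i + 1) ∈ A' := D.pt_mem_arc (i + 1) (j + 1)
  -- `A'` meets the ball only at the mark
  have hsub : A' ⊆ {D.pt i} ∪ (ball (D.pt i) R)ᶜ := by
    intro z hz
    by_cases hzb : dist z (D.pt i) < R
    · left
      obtain ⟨c, rfl⟩ := (mem_frontier_iff_graph hs ht hU hV hΩ hlip hepi hzb).1 (D.arc_subset_frontier _ hz)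
      rcases lt_trichotomy c α with hc | rfl | hc
      · rcases eq_pt_of_mem_arc_arc' D i j (hdn c hc hzb) hz with h | h
        · exact h
        · rw [h] at hzb; linarith
      · exact hp.symm
      · rcases eq_pt_of_mem_arc_arc' D i j (hup c hc hzb) hz with h | h
        · exact h
        · rw [h] at hzb; linarith
    · right; exact hzb
  have hdisj : A' ∩ ({D.pt i} ∩ (ball (D.pt i) R)ᶜ) = ∅ := by
    ext z
    simp only [mem_inter_iff, mem_singleton_iff, mem_compl_iff, mem_ball, not_lt, mem_empty_iff_false,
      iff_false, not_and, not_le]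
    rintro - rfl
    rw [dist_self]; exact hR
  rcases (isPreconnected_iff_subset_of_disjoint_closed.1 hconn) _ _ isClosed_singleton
    isOpen_ball.isClosed_compl hsub hdisj with h | h
  · have := h hqA
    rw [mem_singleton_iff] at this
    have hne : D.pt (i + 1) ≠ D.pt i := fun h' => by
      have := D.pt_injective h'
      revert this; fin_cases i <;> decide
    exact hne this
  · exact h hpA (mem_ball_self hR)

include hs ht hU hV hp hmono hlip hepi hfar in
/-- **The two arcs near a smooth mark are the two half-graphs.** There is `σ : Fin 2` such that,
inside `B(D.pt i, R)`, graph points with parameter `> α` lie on `D.arc σ` and off `D.arc (σ + 1)`,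
while graph points with parameter `< α` lie on `D.arc (σ + 1)` and off `D.arc σ`. [folklore] -/
theorem exists_side_arcs (hΩ : IsOpen D.carrier) (hR : 0 < R) : ∃ σ : Fin 2,
    (∀ c, α < c → dist ((c : ℂ) * U + ((G c : ℝ) : ℂ) * V) (D.pt i) < R →
      (c : ℂ) * U + ((G c : ℝ) : ℂ) * V ∈ D.arc σ ∧ (c : ℂ) * U + ((G c : ℝ) : ℂ) * V ∉ D.arc (σ + 1)) ∧
    (∀ c, c < α → dist ((c : ℂ) * U + ((G c : ℝ) : ℂ) * V) (D.pt i) < R →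
      (c : ℂ) * U + ((G c : ℝ) : ℂ) * V ∈ D.arc (σ + 1) ∧ (c : ℂ) * U + ((G c : ℝ) : ℂ) * V ∉ D.arc σ) := by
  -- exclusivity: a graph point off the mark inside the ball lies on at most one arc
  have hone : ∀ c, c ≠ α → dist ((c : ℂ) * U + ((G c : ℝ) : ℂ) * V) (D.pt i) < R →
      ∀ j : Fin 2, (c : ℂ) * U + ((G c : ℝ) : ℂ) * V ∈ D.arc j →
        (c : ℂ) * U + ((G c : ℝ) : ℂ) * V ∉ D.arc (j + 1) := by
    intro c hc hd j hj hj'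
    rcases eq_pt_of_mem_arc_arc' D i j hj hj' with h | h
    · exact graph_ne_pt D i hs ht hU hV hp hc h
    · rw [h] at hd; linarith
  have hu := halfGraph_subset_arc_or D i hs ht hU hV hp hmono hlip hepi hfar hΩ true
  have hd := halfGraph_subset_arc_or D i hs ht hU hV hp hmono hlip hepi hfar hΩ false
  simp only [↓reduceIte, Bool.false_eq_true] at hu hd
  have key : ∀ σ : Fin 2,
      (∀ c, α < c → dist ((c : ℂ) * U + ((G c : ℝ) : ℂ) * V) (D.pt i) < R →
        (c : ℂ) * U + ((G c : ℝ) : ℂ) * V ∈ D.arc σ) →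
      (∀ c, c < α → dist ((c : ℂ) * U + ((G c : ℝ) : ℂ) * V) (D.pt i) < R →
        (c : ℂ) * U + ((G c : ℝ) : ℂ) * V ∈ D.arc (σ + 1)) →
      ∃ σ : Fin 2,
        (∀ c, α < c → dist ((c : ℂ) * U + ((G c : ℝ) : ℂ) * V) (D.pt i) < R →
          (c : ℂ) * U + ((G c : ℝ) : ℂ) * V ∈ D.arc σ ∧ (c : ℂ) * U + ((G c : ℝ) : ℂ) * V ∉ D.arc (σ + 1)) ∧
        (∀ c, c < α → dist ((c : ℂ) * U + ((G c : ℝ) : ℂ) * V) (D.pt i) < R →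
          (c : ℂ) * U + ((G c : ℝ) : ℂ) * V ∈ D.arc (σ + 1) ∧ (c : ℂ) * U + ((G c : ℝ) : ℂ) * V ∉ D.arc σ) :=
    fun σ h1 h2 => ⟨σ, fun c hc hd => ⟨h1 c hc hd, hone c hc.ne' hd σ (h1 c hc hd)⟩,
      fun c hc hd => ⟨h2 c hc hd, by
        have := hone c hc.ne hd (σ + 1) (h2 c hc hd)
        rwa [show σ + 1 + 1 = σ by fin_cases σ <;> decide] at this⟩⟩
  rcases hu with hu | hu <;> rcases hd with hd | hd
  · exact absurd (not_both_halfGraphs_subset D i hs ht hU hV hp hlip hepi hfar hΩ hR 0 hu hd) id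
  · exact key 0 hu hd
  · exact key 1 hu hd
  · exact absurd (not_both_halfGraphs_subset D i hs ht hU hV hp hlip hepi hfar hΩ hR 1 hu hd) id

end SideArcs

end SmoothMark

/-! ### Registered sub-goal (one-line signature, verbatim) -/

/-- **Registered sub-goal `smoothMark_part5` of `stub_smoothMarkFamilies`**: near a smooth mark the two arcs of a Dobrushin domain are the two half-graphs. [folklore] -/
theorem smoothMark_part5 : ∀ (D : DobrushinDomain) (i : Fin 2) (k : Fin 2) (s t : ℤ) (U V : ℂ) (G : ℝ → ℝ) (α R : ℝ), (s = 1 ∨ s = -1) → (t = 1 ∨ t = -1) → U = Site.toComplex (Pi.single k s) → V = Site.toComplex (Pi.single k.rev t) → D.pt i = (α : ℂ) * U + ((G α : ℝ) : ℂ) * V → Monotone G → (∀ a b, |G a - G b| ≤ |a - b|) → (∀ a b : ℝ, dist ((a : ℂ) * U + (b : ℂ) * V) (D.pt i) < R → ((a : ℂ) * U + (b : ℂ) * V ∈ D.carrier ↔ G a < b)) → R ≤ dist (D.pt (i + 1)) (D.pt i) → 0 < R → ∃ σ : Fin 2, (∀ c, α < c → dist ((c : ℂ) * U + ((G c : ℝ)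 : ℂ) * V) (D.pt i) < R → (c : ℂ) * U + ((G c : ℝ) : ℂ) * V ∈ D.arc σ ∧ (c : ℂ) * U + ((G c : ℝ) : ℂ) * V ∉ D.arc (σ + 1)) ∧ (∀ c, c < α → dist ((c : ℂ) * U + ((G c : ℝ) : ℂ) * V) (D.pt i) < R → (c : ℂ) * U + ((G c : ℝ) : ℂ) * V ∈ D.arc (σ + 1) ∧ (c : ℂ) * U + ((G c : ℝ) : ℂ) * V ∉ D.arc σ) :=
  fun D i _ _ _ _ _ _ _ _ hs ht hU hV hp hmono hlip hepi hfar hR =>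
    SmoothMark.exists_side_arcs D i hs ht hU hV hp hmono hlip hepi hfar D.isOpen hR

end Summit.CriticalPhenomena.CardyFormulaZ2.Cruxes.SLESixFamiliesGiveCardy.CollarTouchSandwich

end
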